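import Summits.ValiantsHypothesis.ValiantsHypothesis.Theorems.LacunarySymmetroidMatrixDescartesCensusDoorA34NodeRows

/-!
# `MatrixDescartes` census — DOOR A at `(3,4)`: ORGANISING CENTRES of the node form — the exact first-order families behind the located
# extremisers (product of three node forms; the isotropic family)

HONEST FRAMING.  Object-search cell `pub-symmetroid`, door-A seat `val-sym-door-p3` (g18); item stmt-ValiantsHypothesis-19980
`DoorA34 = PosRootLawAt 3 4 18` is OPEN and asserted nowhere in this file.  This file records POLYNOMIAL IDENTITIES ONLY (any commutative ring):
the expansions of Cayley's `e₃` (the node form of the door, `…NodeRows.doorA34_iff_nodeRows`) at the degenerate configurations («organising centres»)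
on which the census extremisers of record sit (report `HOME/DOOR-A34-P3G18-REPORT.md` §3, located).  Nothing here bounds anything; nothing bears on
`MatrixDescartes` (stmt-ValiantsHypothesis-18050) or on `VP ≠ VNP`.

CONTENT (no `def`, no `sorry`; `e₃(y) = y₀y₁y₂ + y₀y₁y₃ + y₀y₂y₃ + y₁y₂y₃` is written out).
* `e3_affine` — `e₃` is AFFINE in each node: `e₃(m₀,m₁,m₂+t,m₃) = e₃(m) + t·e₂(m₀,m₁,m₃)`.  Located reading (FLAG eighteens on `(0,1,4,N)`): the top
  exponent `x^N` sits in ONE node form (`t = c·x^N`; the other three carry it at relative size `1e-129`), so `det = e₃(core) + c·x^N·e₂ + …` —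
  a `(3,3)`-type nine plus explicit window terms.
* `e3_oppositePairs` — `e₃(a, b, −b, −a) = 0`: the OPPOSITE-PAIR centre is identically singular; `e3_unfold_oppositePairs` — the exact unfolding
  `e₃(a+m₀, b+m₁, −b+m₂, −a+m₃) = −(b²(m₀+m₃) + a²(m₁+m₂)) + [(a+b)(m₂m₃ − m₀m₁) + (a−b)(m₁m₃ − m₀m₂)] + e₃(m)`: the FIRST-ORDER family is the
  ISOTROPIC family `α²w + β²u` (the cell's isotropic sub-door).  Located reading: the W-family seventeens (`m₀+m₁`, `m₂+m₃` vanish to `1e-4` on the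
  low exponents).
* `R2_pairScaling` — in class R2, scaling the conjugate pair `(P,Q) ↦ (δP, δQ)` gives `δ·(2PL₀L₁) + δ²·(P²+Q²)(L₀+L₁)`: leading term a PRODUCT of
  three node forms (RAIL seventeens on `(0,2,5,N)`).  `R0_realScaling` — in class R0, `(P,R) ↦ (δP, δR)` gives `δ·(RQ² + PS²) + δ³·PR(P+R)`: leading
  term the isotropic family again (R0 seventeens).  `R4_oneNodeScaling` — `e₃(m₀,m₁,m₂,δm₃) = m₀m₁m₂ + δ·m₃e₂(m₀,m₁,m₂)`: product leading term.
[folklore] Elementary algebra; the located assignments are the report's, not theorems.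
-/

-- `Summit.ValiantsHypothesis.ValiantsHypothesis.…` repeats a component by the D-0017 layout
-- (single-conjunct summit), which the `dupNamespace` linter flags; the name is mandated.
set_option linter.dupNamespace false

namespace Summit.ValiantsHypothesis.ValiantsHypothesis.Theorems.LacunarySymmetroidMatrixDescartes.Census.EqualDiagonal

/-! ## 24. Organising centres of `e₃` in node coordinates -/

section Centres

variable {R : Type*} [CommRing R]

/-- **`e₃` is affine in each node**: moving one node form by `t` adds `t·e₂` of the other three.  (FLAG reading: `t = c·x^N`.) [folklore] -/
theorem e3_affine (m₀ m₁ m₂ m₃ t : R) :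
    m₀ * m₁ * (m₂ + t) + m₀ * m₁ * m₃ + m₀ * (m₂ + t) * m₃ + m₁ * (m₂ + t) * m₃
      = (m₀ * m₁ * m₂ + m₀ * m₁ * m₃ + m₀ * m₂ * m₃ + m₁ * m₂ * m₃) + t * (m₀ * m₁ + m₀ * m₃ + m₁ * m₃) := by
  ring

/-- **One node form scaled**: `e₃(m₀,m₁,m₂,δ·m₃) = m₀m₁m₂ + δ·m₃·e₂(m₀,m₁,m₂)` — as `δ → 0` the leading term is a PRODUCT of three node forms.
[folklore] -/
theorem R4_oneNodeScaling (m₀ m₁ m₂ m₃ δ : R) :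
    m₀ * m₁ * m₂ + m₀ * m₁ * (δ * m₃) + m₀ * m₂ * (δ * m₃) + m₁ * m₂ * (δ * m₃)
      = m₀ * m₁ * m₂ + δ * (m₃ * (m₀ * m₁ + m₀ * m₂ + m₁ * m₂)) := by
  ring

/-- **The opposite-pair centre is identically singular**: `e₃(a, b, −b, −a) = 0`. [folklore] -/
theorem e3_oppositePairs (a b : R) :
    a * b * (-b) + a * b * (-a) + a * (-b) * (-a) + b * (-b) * (-a) = 0 := by
  ring

/-- **Exact unfolding of the opposite-pair centre**: `e₃(a+m₀, b+m₁, −b+m₂, −a+m₃)` = (first order) `−(b²(m₀+m₃) + a²(m₁+m₂))` — the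
ISOTROPIC family — `+` (second order) `(a+b)(m₂m₃ − m₀m₁) + (a−b)(m₁m₃ − m₀m₂)` `+` `e₃(m)`. [folklore] -/
theorem e3_unfold_oppositePairs (a b m₀ m₁ m₂ m₃ : R) :
    (a + m₀) * (b + m₁) * (-b + m₂) + (a + m₀) * (b + m₁) * (-a + m₃) + (a + m₀) * (-b + m₂) * (-a + m₃)
        + (b + m₁) * (-b + m₂) * (-a + m₃)
      = -(b ^ 2 * (m₀ + m₃) + a ^ 2 * (m₁ + m₂))
        + ((a + b) * (m₂ * m₃ - m₀ * m₁) + (a - b) * (m₁ * m₃ - m₀ * m₂))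
        + (m₀ * m₁ * m₂ + m₀ * m₁ * m₃ + m₀ * m₂ * m₃ + m₁ * m₂ * m₃) := by
  ring

/-- The same unfolding with a scale `δ` on the perturbation: orders `δ`, `δ²`, `δ³` separate the isotropic family, the quadratic correction and
`e₃(m)`. [folklore] -/
theorem e3_unfold_oppositePairs_scaled (a b m₀ m₁ m₂ m₃ δ : R) :
    (a + δ * m₀) * (b + δ * m₁) * (-b + δ * m₂) + (a + δ * m₀) * (b + δ * m₁) * (-a + δ * m₃)
        + (a + δ * m₀) * (-b + δ * m₂) * (-a + δ * m₃) + (b + δ * m₁) * (-b + δ * m₂) * (-a + δ * m₃)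
      = δ * (-(b ^ 2 * (m₀ + m₃) + a ^ 2 * (m₁ + m₂)))
        + δ ^ 2 * ((a + b) * (m₂ * m₃ - m₀ * m₁) + (a - b) * (m₁ * m₃ - m₀ * m₂))
        + δ ^ 3 * (m₀ * m₁ * m₂ + m₀ * m₁ * m₃ + m₀ * m₂ * m₃ + m₁ * m₂ * m₃) := by
  ring

/-- **Class R2, conjugate pair scaled**: `(P,Q) ↦ (δP, δQ)` in `(P²+Q²)(L₀+L₁) + 2PL₀L₁` gives `δ·2PL₀L₁ + δ²·(P²+Q²)(L₀+L₁)` — leading term a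
PRODUCT of three node forms (RAIL reading). [folklore] -/
theorem R2_pairScaling (P Q L₀ L₁ δ : R) :
    ((δ * P) ^ 2 + (δ * Q) ^ 2) * (L₀ + L₁) + 2 * (δ * P) * L₀ * L₁
      = δ * (2 * P * L₀ * L₁) + δ ^ 2 * ((P ^ 2 + Q ^ 2) * (L₀ + L₁)) := by
  ring

/-- **Class R0, real parts scaled**: `(P,R) ↦ (δP, δR)` in `R(P²+Q²) + P(R²+S²)` gives `δ·(RQ² + PS²) + δ³·PR(P+R)` — leading term the ISOTROPIC
family (R0 seventeens reading). [folklore] -/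
theorem R0_realScaling (P Q R' S δ : R) :
    (δ * R') * ((δ * P) ^ 2 + Q ^ 2) + (δ * P) * ((δ * R') ^ 2 + S ^ 2)
      = δ * (R' * Q ^ 2 + P * S ^ 2) + δ ^ 3 * (P * R' * (P + R')) := by
  ring

/-- **Class R0 is «isotropic + cubic»**: `R(P²+Q²) + P(R²+S²) = (RQ² + PS²) + PR(P+R)` — the R0 node polynomial is the isotropic family plus the
product term `PR(P+R)`. [folklore] -/
theorem R0_eq_isotropic_add (P Q R' S : R) :
    R' * (P ^ 2 + Q ^ 2) + P * (R' ^ 2 + S ^ 2) = (R' * Q ^ 2 + P * S ^ 2) + P * R' * (P + R') := by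
  ring

/-- **Double wall**: at a common zero of two node forms the node polynomial vanishes — `e₃(0, 0, m₂, m₃) = 0` — and one more node form kills the
first-order term: `e₃(s, t, m₂, m₃) = (s + t)·m₂m₃ + st(m₂ + m₃)`. [folklore] -/
theorem e3_doubleWall (s t m₂ m₃ : R) :
    s * t * m₂ + s * t * m₃ + s * m₂ * m₃ + t * m₂ * m₃ = (s + t) * (m₂ * m₃) + s * t * (m₂ + m₃) := by
  ring

end Centres

end Summit.ValiantsHypothesis.ValiantsHypothesis.Theorems.LacunarySymmetroidMatrixDescartes.Census.EqualDiagonal
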